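import Literature.NumberTheory.GelbartRogawski1991.WeilLiftNonsplitPrincipalSeriesConstituent
import Literature.NumberTheory.Automorphic.IrreducibleClassesConstituents
import Summits.HodgeConjecture.HodgeConjecture.Theorems.F0P2iThetaTypeCriterion
import HarnessLib

/-!
# Crux `H413`, programme P2, line `F0_P2GR91NJacquet` (#76 U′-N local pay-down) — K1c «OWN CLASS», generic half: the class of
# Liu's local theta type transported to `U(Φ₃)(L⁺_v)` satisfies `ThetaTypeAtCM`, GIVEN that `X_v(μ, ε, χ_f)` is irreducible and smooth

Cell hodgecm-mathlib (D-0151), FLOOR 0, crux item H413 = stmt-HodgeConjecture-24833, programme P2, socket 27455; pay-down line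
`Cruxes/H413/Lines/F0_P2GR91NJacquet.lean` (03185efdbb79 ∕ v1.1), stub K1 `stub_thetaType_in_principalSeries : StubThetaInPS`
(lead B-p18 (g27), K1 LEAD PLAN v0 `F0/P2/B-p18/K1-PLAN.v0.B-p18g27.md` §1, cut K1a «Jacquet functional» ∕ K1b ★ Frobenius
(`Theorems/F0P2nFrobeniusFunctional`) ∕ K1c «own class» ∕ K1-glue).  THIS FILE = K1c (ii)(iii), the model-free plumbing (second hand
F0P2-p05 (g0)); its sequel `Theorems/F0P2oXThetaOwnClass.lean` supplies K1c (i) (irreducibility and smoothness of `X_v`, [Liu2021 Lem. D.1]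
in the tree's model) and the unconditional head `thetaTypeAtCM_self`.  THEOREMS ONLY (no `def`, no instance, no notation, no named fact,
no `sorry`); kernel lane `--supports stmt-HodgeConjecture-24833 --as helper`.  HC_CM is proved only modulo the 2 remaining named inputs
(hLiu418, h413) until rung 0 closes; this file discharges none of them.

WHAT K1 NEEDS FROM K1c.  K1 asks for `∃ ε x₀ ψθ, CenterCharSpec … ∧ x₀.IsConstituentOf (i_G(χθ)) ∧ ThetaTypeAtCM … ε v
(IrrClass.comap (cmDatumLocalCongr L v T ha h).symm x₀)`.  K1b (★ `isConstituentOf_mk_cmPrincipalSeries_xi_of_functional`) produces the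
middle conjunct for `x₀ := ⟦πG⟧`, the class of an IRREDUCIBLE SMOOTH representation `πG` of `Gqs L v = U(Φ₃)(L⁺_v)` carrying K1a's
functional.  Here, for
  `πH := X_v(μ,ε,χ_f) ∘ κ_v⁻¹` on `localPi … H v` (★ `xThetaCM … ε v` along the frame congruence ★ `localCongr` — the composition
  printed in ★ `ThetaTypeAtCM`) and
  `πG := πH ∘ (localPiEquiv v)⁻¹ ∘ (cmDatumLocalCongr v T)` on `Gqs L v` (avatar change ★ `localPiEquiv`, form congruence ★ `cmDatumLocalCongr`),
GIVEN `hirr : IsIrreducible X_v`, `hsm : IsSmooth X_v`: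
* §2 `πH`, `πG` are irreducible and smooth (`isIrreducible_piH/piG`, `isSmooth_piH/piG` — onto ∕ continuous group isomorphisms); B-p18's
  spelling `x₀ := comap (cmDatumLocalCongr v T) (comap (localPiEquiv v)⁻¹ ⟦πH⟧)` EQUALS `⟦πG⟧` (`x₀_eq_mk`); the read-back identity
  `IrrClass.comap (localPiEquiv v) (IrrClass.comap (cmDatumLocalCongr v T)⁻¹ ⟦πG⟧) = ⟦πH⟧` (`comap_comap_symm_mk_piG`);
* §3 `thetaTypeAtCM_mk_piG : ThetaTypeAtCM L H e₁ dV hdV hdV0 g hg μ hμ χf ε v (IrrClass.comap (cmDatumLocalCongr L v T ha h).symm ⟦πG⟧)` and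
  `thetaTypeAtCM_x₀` (B-p18's spelling) — a constituent of an IRREDUCIBLE `τ` is `≃ τ` and isotypic components only see the type up to `≃`
  (★ `F0P2iThetaTypeCriterion.isotypicComponent_eq_top_of_isConstituentOf_of_mk_eq`).

## References
* [GelbartRogawski1991] S. Gelbart, J. Rogawski, Invent. Math. 105 (1991), §5.1 (5.1.1), Lem. 5.1.2 p. 466.
* [Liu2021] Y. Liu, Camb. J. Math. 9 (2021) = arXiv:2102.11518: Def. 4.11 (l. 2090–2096).
* [BushnellHenniart2006] C. Bushnell, G. Henniart, Grundlehren 335, §1.1, §2.  [BourbakiAlgebreVIII2012] Algèbre VIII §4 n°2.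
* [PlatonovRapinchuk1994] V. Platonov, A. Rapinchuk, §2.3 (local congruences).  [Rogawski1990] J. Rogawski, §12.2 p. 173.
-/

set_option autoImplicit false
-- the mandated namespace has the single-problem summit's repeated segment (`HodgeConjecture.HodgeConjecture`)
set_option linter.dupNamespace false

noncomputable section

open NumberField IsDedekindDomain MeasureTheory
open scoped Matrix

namespace Summit.HodgeConjecture.HodgeConjecture.Cruxes.H413.F0P2oThetaTypeOwnClass

open Literature.NumberTheory Literature.NumberTheory.Automorphic Literature.NumberTheory.Automorphic.UnitaryGroup
open Literature.NumberTheory.Automorphic.IdeleClassGroup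
open Literature.NumberTheory.Automorphic.Liu2021 Literature.NumberTheory.Automorphic.Liu2021.Def411WeilCarriers
open Literature.NumberTheory.GelbartRogawski1991
open Literature.NumberTheory.GaloisRepresentations
open Literature.NumberTheory.Rogawski1990

/-! ## §2 The transports `πH = X_v ∘ κ_v⁻¹` on `localPi … H v` and `πG` on `Gqs L v = U(Φ₃)(L⁺_v)` -/

section Transport

variable (L : Type) [Field L] [NumberField L] [IsCMField L] (H : Matrix (Fin 3) (Fin 3) L) {n' : ℕ} (e₁ : Fin 3 × Fin 1 ≃ Fin n')
    (dV : Fin 3 → L) (hdV : ∀ i, IsCMField.complexConj L (dV i) = dV i) (hdV0 : ∀ i, dV i ≠ 0) (g : GL (Fin 3) L)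
    (hg : ((g : Matrix (Fin 3) (Fin 3) L).map (cmConjRingHom L))ᵀ * H * (g : Matrix (Fin 3) (Fin 3) L) = Matrix.diagonal dV)
    (μ : Literature.NumberTheory.Automorphic.IdeleClassGroup L →ₜ* Circle) (hμ : IsConjugateSymplectic L μ)
    (χf : UnitaryGroup.finAdelicOne (↥(maximalRealSubfield L)) L (IsCMField.complexConj L) →* ℂˣ) (ε : (↥(maximalRealSubfield L))ˣ)
    (v : HeightOneSpectrum (𝓞 ↥(maximalRealSubfield L)))
    (T : GL (Fin 3) (UnitaryGroup.LocalRing L v)) (a : UnitaryGroup.LocalRing L v) (ha : IsUnit a)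
    (h : formCongr (conjLocal L (IsCMField.complexConj L) v) T (H.map (algebraMap L (UnitaryGroup.LocalRing L v))) =
      a • (Matrix.of fun i j : Fin 3 => if i.val + j.val + 1 = 3 then (1 : L) else 0).map (algebraMap L (UnitaryGroup.LocalRing L v)))

include hg

set_option synthInstance.maxHeartbeats 400000 in
set_option maxHeartbeats 8000000 in
/-- `πH := X_v(μ,ε,χ_f) ∘ κ_v⁻¹` (★ `xThetaCM` moved to `U(H)(L⁺_v)` along the frame congruence ★ `localCongr`, the composition printed in
★ `ThetaTypeAtCM`) is IRREDUCIBLE when `X_v` is (`κ_v⁻¹` is onto). [cite: PlatonovRapinchuk1994, §2.3] [cite: BushnellHenniart2006, §1.1] -/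
theorem isIrreducible_piH (hirr : Representation.IsIrreducible (xThetaCM L e₁ dV hdV hdV0 μ hμ χf ε v)) :
    Representation.IsIrreducible
      ((xThetaCM L e₁ dV hdV hdV0 μ hμ χf ε v :
        localPi L (IsCMField.complexConj L) 3 (Matrix.diagonal dV) v →* _).comp
      (localCongr L (IsCMField.complexConj L) g one_ne_zero
        (by rw [one_smul]; exact hg) v).symm.toMulEquiv.toMonoidHom) :=
  hirr.comp_of_surjective _ (localCongr L (IsCMField.complexConj L) g one_ne_zero
        (by rw [one_smul]; exact hg) v).symm.surjective

set_option synthInstance.maxHeartbeats 400000 in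
set_option maxHeartbeats 8000000 in
/-- `πH := X_v(μ,ε,χ_f) ∘ κ_v⁻¹` is SMOOTH when `X_v` is (`κ_v⁻¹` is continuous). [cite: PlatonovRapinchuk1994, §2.3] [cite: BushnellHenniart2006, §1.1] -/
theorem isSmooth_piH (hsm : Representation.IsSmooth (xThetaCM L e₁ dV hdV hdV0 μ hμ χf ε v)) :
    Representation.IsSmooth
      ((xThetaCM L e₁ dV hdV hdV0 μ hμ χf ε v :
        localPi L (IsCMField.complexConj L) 3 (Matrix.diagonal dV) v →* _).comp
      (localCongr L (IsCMField.complexConj L) g one_ne_zero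
        (by rw [one_smul]; exact hg) v).symm.toMulEquiv.toMonoidHom) :=
  hsm.comp _ (localCongr L (IsCMField.complexConj L) g one_ne_zero
        (by rw [one_smul]; exact hg) v).symm.continuous

set_option synthInstance.maxHeartbeats 400000 in
set_option maxHeartbeats 8000000 in
/-- **`πG := X_v(μ,ε,χ_f) ∘ κ_v⁻¹ ∘ (localPiEquiv v)⁻¹ ∘ (cmDatumLocalCongr v T)` on `Gqs L v = U(Φ₃)(L⁺_v)` is IRREDUCIBLE** when `X_v` is
(every map in the chain is onto) — the `hirr` that K1b's ★ `isConstituentOf_mk_cmPrincipalSeries_xi_of_functional` wants.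
[cite: PlatonovRapinchuk1994, §2.3] [cite: BushnellHenniart2006, §1.1] [cite: Rogawski1990, §12.2 p. 173] -/
theorem isIrreducible_piG (hirr : Representation.IsIrreducible (xThetaCM L e₁ dV hdV hdV0 μ hμ χf ε v)) :
    Representation.IsIrreducible
      ((((xThetaCM L e₁ dV hdV hdV0 μ hμ χf ε v :
        localPi L (IsCMField.complexConj L) 3 (Matrix.diagonal dV) v →* _).comp
      (localCongr L (IsCMField.complexConj L) g one_ne_zero
        (by rw [one_smul]; exact hg) v).symm.toMulEquiv.toMonoidHom).comp
      (localPiEquiv L (IsCMField.complexConj L) 3 H v).symm.toMulEquiv.toMonoidHom).comp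
      (cmDatumLocalCongr L v T ha h).toMulEquiv.toMonoidHom) :=
  ((isIrreducible_piH L H e₁ dV hdV hdV0 g hg μ hμ χf ε v hirr).comp_of_surjective _
    (localPiEquiv L (IsCMField.complexConj L) 3 H v).symm.surjective).comp_of_surjective _ (cmDatumLocalCongr L v T ha h).surjective

set_option synthInstance.maxHeartbeats 400000 in
set_option maxHeartbeats 8000000 in
/-- **`πG` is SMOOTH** when `X_v` is (every map in the chain is continuous) — the `hπ` of K1b.
[cite: PlatonovRapinchuk1994, §2.3] [cite: BushnellHenniart2006, §1.1] -/
theorem isSmooth_piG (hsm : Representation.IsSmooth (xThetaCM L e₁ dV hdV hdV0 μ hμ χf ε v)) :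
    Representation.IsSmooth
      ((((xThetaCM L e₁ dV hdV hdV0 μ hμ χf ε v :
        localPi L (IsCMField.complexConj L) 3 (Matrix.diagonal dV) v →* _).comp
      (localCongr L (IsCMField.complexConj L) g one_ne_zero
        (by rw [one_smul]; exact hg) v).symm.toMulEquiv.toMonoidHom).comp
      (localPiEquiv L (IsCMField.complexConj L) 3 H v).symm.toMulEquiv.toMonoidHom).comp
      (cmDatumLocalCongr L v T ha h).toMulEquiv.toMonoidHom) :=
  ((isSmooth_piH L H e₁ dV hdV hdV0 g hg μ hμ χf ε v hsm).comp _
    (localPiEquiv L (IsCMField.complexConj L) 3 H v).symm.continuous).comp _ (cmDatumLocalCongr L v T ha h).continuous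

set_option synthInstance.maxHeartbeats 400000 in
set_option maxHeartbeats 8000000 in
/-- **THE TWO SPELLINGS OF `x₀` AGREE**: B-p18's `x₀ := comap (cmDatumLocalCongr v T) (comap (localPiEquiv v)⁻¹ ⟦πH⟧)` IS the class `⟦πG⟧` of
the representative `πG = πH ∘ (localPiEquiv v)⁻¹ ∘ (cmDatumLocalCongr v T)` (★ `IrrClass.comap_mk` twice; the identity of the space
intertwines). [cite: BushnellHenniart2006, §1.1] -/
theorem x₀_eq_mk (hirr : Representation.IsIrreducible (xThetaCM L e₁ dV hdV hdV0 μ hμ χf ε v))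
    (hsm : Representation.IsSmooth (xThetaCM L e₁ dV hdV hdV0 μ hμ χf ε v)) :
    IrrClass.comap (cmDatumLocalCongr L v T ha h)
        (IrrClass.comap (localPiEquiv L (IsCMField.complexConj L) 3 H v).symm
          (IrrClass.mk
            { V := _,
              ρ := ((xThetaCM L e₁ dV hdV hdV0 μ hμ χf ε v :
                    localPi L (IsCMField.complexConj L) 3 (Matrix.diagonal dV) v →* _).comp
                  (localCongr L (IsCMField.complexConj L) g one_ne_zero
                    (by rw [one_smul]; exact hg) v).symm.toMulEquiv.toMonoidHom),
              isIrreducible := isIrreducible_piH L H e₁ dV hdV hdV0 g hg μ hμ χf ε v hirr,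
              isSmooth := isSmooth_piH L H e₁ dV hdV hdV0 g hg μ hμ χf ε v hsm })) =
      IrrClass.mk
        { V := _,
          ρ := ((((xThetaCM L e₁ dV hdV hdV0 μ hμ χf ε v :
                localPi L (IsCMField.complexConj L) 3 (Matrix.diagonal dV) v →* _).comp
              (localCongr L (IsCMField.complexConj L) g one_ne_zero
                (by rw [one_smul]; exact hg) v).symm.toMulEquiv.toMonoidHom).comp
              (localPiEquiv L (IsCMField.complexConj L) 3 H v).symm.toMulEquiv.toMonoidHom).comp
              (cmDatumLocalCongr L v T ha h).toMulEquiv.toMonoidHom),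
          isIrreducible := isIrreducible_piG L H e₁ dV hdV hdV0 g hg μ hμ χf ε v T a ha h hirr,
          isSmooth := isSmooth_piG L H e₁ dV hdV hdV0 g hg μ hμ χf ε v T a ha h hsm } :=
  IrrClass.mk_eq_mk_of_equiv (Representation.Equiv.mk (LinearEquiv.refl ℂ _) fun _ => rfl)

set_option synthInstance.maxHeartbeats 400000 in
set_option maxHeartbeats 8000000 in
/-- **READ-BACK**: the class `⟦πG⟧ ∈ Irr(U(Φ₃)(L⁺_v))`, moved back to `U(H)(L⁺_v)` along `(cmDatumLocalCongr v T)⁻¹` and read on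
`localPi … H v` through `localPiEquiv v` — the argument of ★ `ThetaTypeAtCM` — IS `⟦πH⟧ = ⟦X_v ∘ κ_v⁻¹⟧`
(★ `IrrClass.comap_mk` is `rfl`; the identity of the space intertwines, `e (e⁻¹ x) = x`). [cite: BushnellHenniart2006, §1.1] [cite: Rogawski1990, §12.2 p. 173] -/
theorem comap_comap_symm_mk_piG (hirr : Representation.IsIrreducible (xThetaCM L e₁ dV hdV hdV0 μ hμ χf ε v))
    (hsm : Representation.IsSmooth (xThetaCM L e₁ dV hdV hdV0 μ hμ χf ε v)) :
    IrrClass.comap (localPiEquiv L (IsCMField.complexConj L) 3 H v)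
        (IrrClass.comap (cmDatumLocalCongr L v T ha h).symm
          (IrrClass.mk
            { V := _,
              ρ := ((((xThetaCM L e₁ dV hdV hdV0 μ hμ χf ε v :
                    localPi L (IsCMField.complexConj L) 3 (Matrix.diagonal dV) v →* _).comp
                  (localCongr L (IsCMField.complexConj L) g one_ne_zero
                    (by rw [one_smul]; exact hg) v).symm.toMulEquiv.toMonoidHom).comp
                  (localPiEquiv L (IsCMField.complexConj L) 3 H v).symm.toMulEquiv.toMonoidHom).comp
                  (cmDatumLocalCongr L v T ha h).toMulEquiv.toMonoidHom),
              isIrreducible := isIrreducible_piG L H e₁ dV hdV hdV0 g hg μ hμ χf ε v T a ha h hirr,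
              isSmooth := isSmooth_piG L H e₁ dV hdV hdV0 g hg μ hμ χf ε v T a ha h hsm })) =
      IrrClass.mk
        { V := _,
          ρ := ((xThetaCM L e₁ dV hdV hdV0 μ hμ χf ε v :
                localPi L (IsCMField.complexConj L) 3 (Matrix.diagonal dV) v →* _).comp
              (localCongr L (IsCMField.complexConj L) g one_ne_zero
                (by rw [one_smul]; exact hg) v).symm.toMulEquiv.toMonoidHom),
          isIrreducible := isIrreducible_piH L H e₁ dV hdV hdV0 g hg μ hμ χf ε v hirr,
          isSmooth := isSmooth_piH L H e₁ dV hdV hdV0 g hg μ hμ χf ε v hsm } := by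
  refine IrrClass.mk_eq_mk_of_equiv (Representation.Equiv.mk (LinearEquiv.refl ℂ _) fun g' => ?_)
  refine LinearMap.ext fun x => ?_
  change (xThetaCM L e₁ dV hdV hdV0 μ hμ χf ε v)
        ((localCongr L (IsCMField.complexConj L) g one_ne_zero (by rw [one_smul]; exact hg) v).symm
          ((localPiEquiv L (IsCMField.complexConj L) 3 H v).symm
            ((cmDatumLocalCongr L v T ha h)
              ((cmDatumLocalCongr L v T ha h).symm
                ((localPiEquiv L (IsCMField.complexConj L) 3 H v) g'))))) x =
      (xThetaCM L e₁ dV hdV hdV0 μ hμ χf ε v)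
        ((localCongr L (IsCMField.complexConj L) g one_ne_zero (by rw [one_smul]; exact hg) v).symm g') x
  rw [ContinuousMulEquiv.apply_symm_apply, ContinuousMulEquiv.symm_apply_apply]

end Transport

/-! ## §3 HEAD: `ThetaTypeAtCM` of the theta type's OWN transported class -/

section Head

variable (L : Type) [Field L] [NumberField L] [IsCMField L] (H : Matrix (Fin 3) (Fin 3) L) {n' : ℕ} (e₁ : Fin 3 × Fin 1 ≃ Fin n')
    (dV : Fin 3 → L) (hdV : ∀ i, IsCMField.complexConj L (dV i) = dV i) (hdV0 : ∀ i, dV i ≠ 0) (g : GL (Fin 3) L)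
    (hg : ((g : Matrix (Fin 3) (Fin 3) L).map (cmConjRingHom L))ᵀ * H * (g : Matrix (Fin 3) (Fin 3) L) = Matrix.diagonal dV)
    (μ : Literature.NumberTheory.Automorphic.IdeleClassGroup L →ₜ* Circle) (hμ : IsConjugateSymplectic L μ)
    (χf : UnitaryGroup.finAdelicOne (↥(maximalRealSubfield L)) L (IsCMField.complexConj L) →* ℂˣ) (ε : (↥(maximalRealSubfield L))ˣ)
    (v : HeightOneSpectrum (𝓞 ↥(maximalRealSubfield L)))
    (T : GL (Fin 3) (UnitaryGroup.LocalRing L v)) (a : UnitaryGroup.LocalRing L v) (ha : IsUnit a)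
    (h : formCongr (conjLocal L (IsCMField.complexConj L) v) T (H.map (algebraMap L (UnitaryGroup.LocalRing L v))) =
      a • (Matrix.of fun i j : Fin 3 => if i.val + j.val + 1 = 3 then (1 : L) else 0).map (algebraMap L (UnitaryGroup.LocalRing L v)))

include hg

set_option synthInstance.maxHeartbeats 400000 in
set_option maxHeartbeats 8000000 in
/-- **K1c (iii), abstract form: `ThetaTypeAtCM` of the OWN class `⟦πG⟧`, GIVEN irreducibility and smoothness of `X_v`.**  For every
irreducible `τ` of `U(H)(L⁺_v)` of which `⟦πH⟧` (= the read-back of `⟦πG⟧`, `comap_comap_symm_mk_piG`) is a constituent, `τ ≃ πH`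
(★ `IrrClass.IsConstituentOf.nonempty_equiv_of_isIrreducible`), so every `τ`-isotypic `ρ′` is `πH = X_v ∘ κ_v⁻¹`-isotypic
(★ `F0P2iThetaTypeCriterion.isotypicComponent_eq_top_of_isConstituentOf_of_mk_eq`). [cite: GelbartRogawski1991, §5.1 (5.1.1), Lem 5.1.2 p. 466]
[cite: BushnellHenniart2006, §1.1, §2] [cite: BourbakiAlgebreVIII2012, VIII §4 n°2] -/
theorem thetaTypeAtCM_mk_piG (hirr : Representation.IsIrreducible (xThetaCM L e₁ dV hdV hdV0 μ hμ χf ε v))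
    (hsm : Representation.IsSmooth (xThetaCM L e₁ dV hdV hdV0 μ hμ χf ε v)) :
    ThetaTypeAtCM L H e₁ dV hdV hdV0 g hg μ hμ χf ε v
      (IrrClass.comap (cmDatumLocalCongr L v T ha h).symm
        (IrrClass.mk
          { V := _,
            ρ := ((((xThetaCM L e₁ dV hdV hdV0 μ hμ χf ε v :
                  localPi L (IsCMField.complexConj L) 3 (Matrix.diagonal dV) v →* _).comp
                (localCongr L (IsCMField.complexConj L) g one_ne_zero
                  (by rw [one_smul]; exact hg) v).symm.toMulEquiv.toMonoidHom).comp
                (localPiEquiv L (IsCMField.complexConj L) 3 H v).symm.toMulEquiv.toMonoidHom).comp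
                (cmDatumLocalCongr L v T ha h).toMulEquiv.toMonoidHom),
            isIrreducible := isIrreducible_piG L H e₁ dV hdV hdV0 g hg μ hμ χf ε v T a ha h hirr,
            isSmooth := isSmooth_piG L H e₁ dV hdV hdV0 g hg μ hμ χf ε v T a ha h hsm })) := by
  intro T' _ _ τ hτ hc W' _ _ ρ' htop
  haveI := hτ
  exact F0P2iThetaTypeCriterion.isotypicComponent_eq_top_of_isConstituentOf_of_mk_eq
    (comap_comap_symm_mk_piG L H e₁ dV hdV hdV0 g hg μ hμ χf ε v T a ha h hirr hsm).symm (Representation.Equiv.refl _) hc ρ' htop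

set_option synthInstance.maxHeartbeats 400000 in
set_option maxHeartbeats 8000000 in
/-- the same for B-p18's spelling `x₀ := comap (cmDatumLocalCongr v T) (comap (localPiEquiv v)⁻¹ ⟦πH⟧)` of the class (`x₀_eq_mk`).
[cite: GelbartRogawski1991, §5.1 (5.1.1), Lem 5.1.2 p. 466] [cite: BushnellHenniart2006, §1.1, §2] -/
theorem thetaTypeAtCM_x₀ (hirr : Representation.IsIrreducible (xThetaCM L e₁ dV hdV hdV0 μ hμ χf ε v))
    (hsm : Representation.IsSmooth (xThetaCM L e₁ dV hdV hdV0 μ hμ χf ε v)) :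
    ThetaTypeAtCM L H e₁ dV hdV hdV0 g hg μ hμ χf ε v
      (IrrClass.comap (cmDatumLocalCongr L v T ha h).symm
        (IrrClass.comap (cmDatumLocalCongr L v T ha h)
          (IrrClass.comap (localPiEquiv L (IsCMField.complexConj L) 3 H v).symm
            (IrrClass.mk
              { V := _,
                ρ := ((xThetaCM L e₁ dV hdV hdV0 μ hμ χf ε v :
                      localPi L (IsCMField.complexConj L) 3 (Matrix.diagonal dV) v →* _).comp
                    (localCongr L (IsCMField.complexConj L) g one_ne_zero
                      (by rw [one_smul]; exact hg) v).symm.toMulEquiv.toMonoidHom),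
                isIrreducible := isIrreducible_piH L H e₁ dV hdV hdV0 g hg μ hμ χf ε v hirr,
                isSmooth := isSmooth_piH L H e₁ dV hdV hdV0 g hg μ hμ χf ε v hsm })))) := by
  rw [x₀_eq_mk L H e₁ dV hdV hdV0 g hg μ hμ χf ε v T a ha h hirr hsm]
  exact thetaTypeAtCM_mk_piG L H e₁ dV hdV hdV0 g hg μ hμ χf ε v T a ha h hirr hsm

end Head

end Summit.HodgeConjecture.HodgeConjecture.Cruxes.H413.F0P2oThetaTypeOwnClass

end
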